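import Literature.MathematicalPhysics.QuantumFieldTheory.ONArchipelagoObligations
import HarnessLib

/-!
# Termwise rules for the `T`, `A`, `S` rows of an `O(N)` archipelago point certificate

Fourth file of the archipelago rung (`ONArchipelagoSystem` → `ONArchipelagoDual` →
`ONArchipelagoObligations`).  For a point 7-vector `α⃗ = ofPoints z z̄ w` (nodes in the open square) and
a genuine block `g^{0,0}_{Δ,ℓ}` at a REGULAR `(Δ, ℓ)` (`unitarityBound3D ℓ < Δ`, no accidental
degeneracy), the three `(0,0)`-block rows of Kos–Poland–Simmons-Duffin–Vichi 2015 §2.2 are `z`-series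
sums of explicit terms at the monomials `𝒫_{E,j}` (`zMono`), with the NON-NEGATIVE rational
coefficients `A_{n,j}/λ_ℓ` (`hrCoeff`, Hogervorst–Rychkov):

* `T`: `tensorForm = Σ (A_{n,j}/λ_ℓ) · tensorTerm(Δ+n, j)`,
  `tensorTerm = Φ¹₋ + (1 − 2/N) Φ²₋ − (1 + 2/N) Φ³₊` (prefactor exponent `Δ_φ`) — a TWO-SIGN ROW with
  weights `a⁻ = w₀ + (1 − 2/N) w₁`, `a⁺ = −(1 + 2/N) w₂` (`tensorTerm_eq_twoSign`);
* `A`: `antiTerm = −Φ¹₋ + Φ²₋ − Φ³₊` — a two-sign row with `a⁻ = −w₀ + w₁`, `a⁺ = −w₂`;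
* `S`: the `2×2` term form `singletTermForm(a,b) = a² (Φ²₋(Δ_φ) + Φ³₊(Δ_φ)) + b² Φ⁴₋(Δ_s)
  + ab (Φ⁶₋(h) + Φ⁷₊(h))`, `h = (Δ_φ+Δ_s)/2`, PSD from three numbers (`singletTermForm_nonneg_of_det`);

hence the HEAD + TERMWISE-TAIL rules `tensorPositive_ofPoints_of_termwise`,
`antiPositive_ofPoints_of_termwise`, `singletPositive_ofPoints_of_termwise` (a finite head sum `≥ 0`
plus every term outside the head non-negative / PSD on the descendant range ⇒ the row obligation at
`(Δ, ℓ)`), literally the pattern of `evenPositive_ofPoints_of_termwise` of the `σ–ε` chain.  The `V` rows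
need nothing new (`vectorPositive_ofPoints_iff`, previous file), and the external obligation follows from
the separate ones when the gaps do not exclude `s`, `φ` themselves (`extPositive_of_separate`).

NON-REGULAR points (the unitarity bound of `ℓ ≥ 1`, accidental degeneracies) are reached from the
right (§4): the forms of a point 7-vector are continuous along the limit clause of `IsConformalBlock3D`,
so a row obligation valid at the regular points of a right neighbourhood holds at the non-regular point
(`tensorPositive_ofPoints_of_eventually_right`, `anti…`, `singlet…`, `vector…` — the last through the
bridge), exactly as `evenPositive_ofPoints_of_eventually_right` in the `σ–ε` chain.

What this file does NOT contain: tails in `Δ → ∞` (the patterns of `PointFunctionalTail` /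
`MixedEvenTail` apply per row class), any table or number.  Here `Φⁱ_∓(E, j, t) = φ_i[F^{t}_{∓}[𝒫_{E,j}]]` with `φ_i = pointFunctional (w (i-1)) z z̄`.

Sources: arXiv:1504.07997 §2.1–2.2 (`KosPolandSimmonsDuffinVichi2015`); M. Hogervorst, S. Rychkov,
Phys. Rev. D 87 (2013) 106004, §3 eq. (3.9) (`HogervorstRychkov2013`); JHEP 11 (2014) 109 §3.2–3.3
(`KosPolandSimmonsduffin2014`).
-/

namespace Literature.MathematicalPhysics.QuantumFieldTheory.ONArchipelagoSystem

open Finset Set Filter Topology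
open ConformalBootstrap3D (IsConformalBlock3D IsRegularPoint3D unitarityBound3D accidentalDegeneracy3D
  crossF CrossingFunctional pointFunctional pointFunctional_apply zMono hrCoeff legendreLam
  InDescendantRange hrCoeff_nonneg hrCoeff_eq_zero_of_not_inDescendantRange legendreLam_pos
  hasSum_pointFunctional_crossF_hrZ quadForm_nonneg_of_det tendsto_pointFunctional_crossF
  oddPositive_ofPoints_of_eventually_right)

namespace ArchipelagoFunctional

/-! ### §1 The `T` and `A` rows (two-sign rows in the `(0,0)` block) -/

/-- The `T`-row term of a point 7-vector at the monomial `𝒫_{E,j}`: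
`Φ¹₋(E,j,Δ_φ) + (1 − 2/N) Φ²₋(E,j,Δ_φ) − (1 + 2/N) Φ³₊(E,j,Δ_φ)`.
[cite: KosPolandSimmonsDuffinVichi2015, §2.1 (seven equations; `V⃗_T`)] -/
noncomputable def tensorTerm {n : ℕ} (z zb : Fin n → ℝ) (w : Fin 7 → Fin n → ℝ) (N : ℕ) (Δφ E : ℝ)
    (j : ℕ) : ℝ :=
  pointFunctional (w 0) z zb (crossF Δφ (-1) (zMono E j)) +
      (1 - 2 / (N : ℝ)) * pointFunctional (w 1) z zb (crossF Δφ (-1) (zMono E j)) -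
    (1 + 2 / (N : ℝ)) * pointFunctional (w 2) z zb (crossF Δφ 1 (zMono E j))

/-- The `A`-row term at `𝒫_{E,j}`: `−Φ¹₋(E,j,Δ_φ) + Φ²₋(E,j,Δ_φ) − Φ³₊(E,j,Δ_φ)`.
[cite: KosPolandSimmonsDuffinVichi2015, §2.1 (seven equations; `V⃗_A`)] -/
noncomputable def antiTerm {n : ℕ} (z zb : Fin n → ℝ) (w : Fin 7 → Fin n → ℝ) (Δφ E : ℝ) (j : ℕ) : ℝ :=
  -pointFunctional (w 0) z zb (crossF Δφ (-1) (zMono E j)) +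
      pointFunctional (w 1) z zb (crossF Δφ (-1) (zMono E j)) -
    pointFunctional (w 2) z zb (crossF Δφ 1 (zMono E j))

/-- **The `T` row is a two-sign row**: `tensorTerm = φ_{a⁻}[F⁻_{Δφ} 𝒫_{E,j}] + φ_{a⁺}[F⁺_{Δφ} 𝒫_{E,j}]`
with the combined weights `a⁻ = w₀ + (1 − 2/N) w₁`, `a⁺ = −(1 + 2/N) w₂` on the same nodes — so the
two-sign head / tail tables of the vector rung serve the `T` rows verbatim.
[cite: KosPolandSimmonsduffin2014ON, §2.1 (sum rules)] -/
theorem tensorTerm_eq_twoSign {n : ℕ} (z zb : Fin n → ℝ) (w : Fin 7 → Fin n → ℝ) (N : ℕ) (Δφ E : ℝ)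
    (j : ℕ) : tensorTerm z zb w N Δφ E j =
      pointFunctional (fun k => w 0 k + (1 - 2 / (N : ℝ)) * w 1 k) z zb (crossF Δφ (-1) (zMono E j)) +
        pointFunctional (fun k => -(1 + 2 / (N : ℝ)) * w 2 k) z zb (crossF Δφ 1 (zMono E j)) := by
  simp only [tensorTerm, pointFunctional_apply, ← Finset.sum_add_distrib, Finset.mul_sum,
    ← Finset.sum_sub_distrib]
  exact Finset.sum_congr rfl fun k _ => by ring

/-- **The `A` row is a two-sign row** with `a⁻ = −w₀ + w₁`, `a⁺ = −w₂`.
[cite: KosPolandSimmonsduffin2014ON, §2.1 (sum rules)] -/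
theorem antiTerm_eq_twoSign {n : ℕ} (z zb : Fin n → ℝ) (w : Fin 7 → Fin n → ℝ) (Δφ E : ℝ) (j : ℕ) :
    antiTerm z zb w Δφ E j =
      pointFunctional (fun k => -w 0 k + w 1 k) z zb (crossF Δφ (-1) (zMono E j)) +
        pointFunctional (fun k => -w 2 k) z zb (crossF Δφ 1 (zMono E j)) := by
  simp only [antiTerm, pointFunctional_apply, ← Finset.sum_add_distrib, ← Finset.sum_sub_distrib,
    ← Finset.sum_neg_distrib]
  exact Finset.sum_congr rfl fun k _ => by ring

/-- **The `T` row is the `z`-series sum of its terms** (regular `(Δ, ℓ)`, genuine `g^{0,0}_{Δ,ℓ}`):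
`tensorForm(g) = Σ_{(n,j)} (A_{n,j}/λ_ℓ) tensorTerm(Δ+n, j)` — three applications of the termwise action
of a point functional. [cite: HogervorstRychkov2013, §3 eq. (3.9)] -/
theorem hasSum_tensorForm_ofPoints {n : ℕ} (z zb : Fin n → ℝ) (w : Fin 7 → Fin n → ℝ)
    (hz : ∀ k, z k ∈ Ioo (0 : ℝ) 1) (hzb : ∀ k, zb k ∈ Ioo (0 : ℝ) 1) {Δ : ℝ} {ℓ : ℕ}
    {g : ℝ → ℝ → ℝ} (hΔ : unitarityBound3D ℓ < Δ) (hreg : ¬ accidentalDegeneracy3D Δ ℓ)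
    (hg : IsConformalBlock3D 0 0 Δ ℓ g) (N : ℕ) (Δφ : ℝ) :
    HasSum (fun q : ℕ × ℕ => hrCoeff Δ ℓ q.1 q.2 / legendreLam ℓ *
        tensorTerm z zb w N Δφ (Δ + (q.1 : ℝ)) q.2) ((ofPoints z zb w).tensorForm N Δφ g) := by
  have h1 := hasSum_pointFunctional_crossF_hrZ (w 0) z zb hz hzb Δφ (-1) hΔ hreg hg
  have h2 := hasSum_pointFunctional_crossF_hrZ (w 1) z zb hz hzb Δφ (-1) hΔ hreg hg
  have h3 := hasSum_pointFunctional_crossF_hrZ (w 2) z zb hz hzb Δφ 1 hΔ hreg hg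
  have hs := (h1.add (h2.mul_left (1 - 2 / (N : ℝ)))).sub (h3.mul_left (1 + 2 / (N : ℝ)))
  have hL : (ofPoints z zb w).tensorForm N Δφ g =
      pointFunctional (w 0) z zb (crossF Δφ (-1) g) +
          (1 - 2 / (N : ℝ)) * pointFunctional (w 1) z zb (crossF Δφ (-1) g) -
        (1 + 2 / (N : ℝ)) * pointFunctional (w 2) z zb (crossF Δφ 1 g) := rfl
  rw [hL]
  exact hs.congr_fun fun q => by simp only [tensorTerm]; ring

/-- **The `A` row is the `z`-series sum of its terms** (regular point, genuine block).
[cite: HogervorstRychkov2013, §3 eq. (3.9)] -/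
theorem hasSum_antiForm_ofPoints {n : ℕ} (z zb : Fin n → ℝ) (w : Fin 7 → Fin n → ℝ)
    (hz : ∀ k, z k ∈ Ioo (0 : ℝ) 1) (hzb : ∀ k, zb k ∈ Ioo (0 : ℝ) 1) {Δ : ℝ} {ℓ : ℕ}
    {g : ℝ → ℝ → ℝ} (hΔ : unitarityBound3D ℓ < Δ) (hreg : ¬ accidentalDegeneracy3D Δ ℓ)
    (hg : IsConformalBlock3D 0 0 Δ ℓ g) (Δφ : ℝ) :
    HasSum (fun q : ℕ × ℕ => hrCoeff Δ ℓ q.1 q.2 / legendreLam ℓ * antiTerm z zb w Δφ (Δ + (q.1 : ℝ)) q.2)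
      ((ofPoints z zb w).antiForm Δφ g) := by
  have h1 := hasSum_pointFunctional_crossF_hrZ (w 0) z zb hz hzb Δφ (-1) hΔ hreg hg
  have h2 := hasSum_pointFunctional_crossF_hrZ (w 1) z zb hz hzb Δφ (-1) hΔ hreg hg
  have h3 := hasSum_pointFunctional_crossF_hrZ (w 2) z zb hz hzb Δφ 1 hΔ hreg hg
  have hs := (h1.neg.add h2).sub h3
  have hL : (ofPoints z zb w).antiForm Δφ g =
      -pointFunctional (w 0) z zb (crossF Δφ (-1) g) + pointFunctional (w 1) z zb (crossF Δφ (-1) g) -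
        pointFunctional (w 2) z zb (crossF Δφ 1 g) := rfl
  rw [hL]
  exact hs.congr_fun fun q => by simp only [antiTerm]; ring

/-- **`T`-row positivity from a finite head and a termwise tail, regular point.** If
`Σ_{(n,j) ∈ F} (A_{n,j}/λ_ℓ) tensorTerm(Δ+n, j) ≥ 0` and every term outside `F` on the descendant range is
`≥ 0`, then `TensorPositive` at `(Δ, ℓ)`. [cite: HogervorstRychkov2013, §3 eq. (3.9)] -/
theorem tensorPositive_ofPoints_of_termwise {n : ℕ} (z zb : Fin n → ℝ) (w : Fin 7 → Fin n → ℝ)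
    (hz : ∀ k, z k ∈ Ioo (0 : ℝ) 1) (hzb : ∀ k, zb k ∈ Ioo (0 : ℝ) 1) {N : ℕ} {Δφ Δ : ℝ} {ℓ : ℕ}
    (hΔ : unitarityBound3D ℓ < Δ) (hreg : ¬ accidentalDegeneracy3D Δ ℓ) (F : Finset (ℕ × ℕ))
    (hhead : 0 ≤ ∑ q ∈ F, hrCoeff Δ ℓ q.1 q.2 / legendreLam ℓ * tensorTerm z zb w N Δφ (Δ + (q.1 : ℝ)) q.2)
    (htail : ∀ q : ℕ × ℕ, q ∉ F → InDescendantRange ℓ q.1 q.2 →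
      0 ≤ tensorTerm z zb w N Δφ (Δ + (q.1 : ℝ)) q.2) :
    (ofPoints z zb w).TensorPositive N Δφ Δ ℓ := by
  intro g hg
  have hS := hasSum_tensorForm_ofPoints z zb w hz hzb hΔ hreg hg N Δφ
  refine hhead.trans (sum_le_hasSum F (fun q hq => ?_) hS)
  by_cases hr : InDescendantRange ℓ q.1 q.2
  · exact mul_nonneg (div_nonneg (hrCoeff_nonneg hΔ _ _) (legendreLam_pos ℓ).le) (htail q hq hr)
  · rw [hrCoeff_eq_zero_of_not_inDescendantRange Δ hr, zero_div, zero_mul]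

/-- **`A`-row positivity from a finite head and a termwise tail, regular point.**
[cite: HogervorstRychkov2013, §3 eq. (3.9)] -/
theorem antiPositive_ofPoints_of_termwise {n : ℕ} (z zb : Fin n → ℝ) (w : Fin 7 → Fin n → ℝ)
    (hz : ∀ k, z k ∈ Ioo (0 : ℝ) 1) (hzb : ∀ k, zb k ∈ Ioo (0 : ℝ) 1) {Δφ Δ : ℝ} {ℓ : ℕ}
    (hΔ : unitarityBound3D ℓ < Δ) (hreg : ¬ accidentalDegeneracy3D Δ ℓ) (F : Finset (ℕ × ℕ))
    (hhead : 0 ≤ ∑ q ∈ F, hrCoeff Δ ℓ q.1 q.2 / legendreLam ℓ * antiTerm z zb w Δφ (Δ + (q.1 : ℝ)) q.2)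
    (htail : ∀ q : ℕ × ℕ, q ∉ F → InDescendantRange ℓ q.1 q.2 →
      0 ≤ antiTerm z zb w Δφ (Δ + (q.1 : ℝ)) q.2) :
    (ofPoints z zb w).AntiPositive Δφ Δ ℓ := by
  intro g hg
  have hS := hasSum_antiForm_ofPoints z zb w hz hzb hΔ hreg hg Δφ
  refine hhead.trans (sum_le_hasSum F (fun q hq => ?_) hS)
  by_cases hr : InDescendantRange ℓ q.1 q.2
  · exact mul_nonneg (div_nonneg (hrCoeff_nonneg hΔ _ _) (legendreLam_pos ℓ).le) (htail q hq hr)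
  · rw [hrCoeff_eq_zero_of_not_inDescendantRange Δ hr, zero_div, zero_mul]

/-! ### §2 The `S` rows (`2×2` forms with a two-sign entry) -/

/-- **The singlet term form** of a point 7-vector at `𝒫_{E,j}`:
`q_{E,j}(a,b) = a² (Φ²₋(E,j,Δ_φ) + Φ³₊(E,j,Δ_φ)) + b² Φ⁴₋(E,j,Δ_s) + ab (Φ⁶₋(E,j,h) + Φ⁷₊(E,j,h))`,
`h = (Δ_φ+Δ_s)/2`. [cite: KosPolandSimmonsDuffinVichi2015, §2.1 (seven equations; `V⃗_S`)] -/
noncomputable def singletTermForm {n : ℕ} (z zb : Fin n → ℝ) (w : Fin 7 → Fin n → ℝ) (Δφ Δs E : ℝ)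
    (j : ℕ) (a b : ℝ) : ℝ :=
  a ^ 2 * (pointFunctional (w 1) z zb (crossF Δφ (-1) (zMono E j)) +
      pointFunctional (w 2) z zb (crossF Δφ 1 (zMono E j))) +
    b ^ 2 * pointFunctional (w 3) z zb (crossF Δs (-1) (zMono E j)) +
    a * b * (pointFunctional (w 5) z zb (crossF ((Δφ + Δs) / 2) (-1) (zMono E j)) +
      pointFunctional (w 6) z zb (crossF ((Δφ + Δs) / 2) 1 (zMono E j)))

/-- **Termwise PSD from three numbers**: `X = Φ²₋ + Φ³₊ ≥ 0`, `Y = Φ⁴₋ ≥ 0`, `Z² ≤ 4XY` with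
`Z = Φ⁶₋ + Φ⁷₊` give `q_{E,j}(a,b) ≥ 0` for all `(a,b)`. Elementary. [cite: KosPolandSimmonsduffin2014, §3.3 eq. (3.16)] -/
theorem singletTermForm_nonneg_of_det {n : ℕ} (z zb : Fin n → ℝ) (w : Fin 7 → Fin n → ℝ)
    {Δφ Δs E : ℝ} {j : ℕ}
    (hX : 0 ≤ pointFunctional (w 1) z zb (crossF Δφ (-1) (zMono E j)) +
      pointFunctional (w 2) z zb (crossF Δφ 1 (zMono E j)))
    (hY : 0 ≤ pointFunctional (w 3) z zb (crossF Δs (-1) (zMono E j)))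
    (hZ : (pointFunctional (w 5) z zb (crossF ((Δφ + Δs) / 2) (-1) (zMono E j)) +
        pointFunctional (w 6) z zb (crossF ((Δφ + Δs) / 2) 1 (zMono E j))) ^ 2 ≤
      4 * (pointFunctional (w 1) z zb (crossF Δφ (-1) (zMono E j)) +
          pointFunctional (w 2) z zb (crossF Δφ 1 (zMono E j))) *
        pointFunctional (w 3) z zb (crossF Δs (-1) (zMono E j))) :
    ∀ a b : ℝ, 0 ≤ singletTermForm z zb w Δφ Δs E j a b :=
  fun a b => quadForm_nonneg_of_det hX hY hZ a b

/-- **The singlet form is the `z`-series sum of the term forms** (regular point, genuine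
`g^{0,0}_{Δ,ℓ}`): `singletForm(g; a, b) = Σ_{(n,j)} (A_{n,j}/λ_ℓ) q_{Δ+n,j}(a,b)` — five applications of
the termwise action of a point functional. [cite: HogervorstRychkov2013, §3 eq. (3.9)] -/
theorem hasSum_singletForm_ofPoints {n : ℕ} (z zb : Fin n → ℝ) (w : Fin 7 → Fin n → ℝ)
    (hz : ∀ k, z k ∈ Ioo (0 : ℝ) 1) (hzb : ∀ k, zb k ∈ Ioo (0 : ℝ) 1) {Δ : ℝ} {ℓ : ℕ}
    {g : ℝ → ℝ → ℝ} (hΔ : unitarityBound3D ℓ < Δ) (hreg : ¬ accidentalDegeneracy3D Δ ℓ)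
    (hg : IsConformalBlock3D 0 0 Δ ℓ g) (Δφ Δs a b : ℝ) :
    HasSum (fun q : ℕ × ℕ => hrCoeff Δ ℓ q.1 q.2 / legendreLam ℓ *
        singletTermForm z zb w Δφ Δs (Δ + (q.1 : ℝ)) q.2 a b)
      ((ofPoints z zb w).singletForm Δφ Δs g a b) := by
  have h2 := hasSum_pointFunctional_crossF_hrZ (w 1) z zb hz hzb Δφ (-1) hΔ hreg hg
  have h3 := hasSum_pointFunctional_crossF_hrZ (w 2) z zb hz hzb Δφ 1 hΔ hreg hg
  have h4 := hasSum_pointFunctional_crossF_hrZ (w 3) z zb hz hzb Δs (-1) hΔ hreg hg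
  have h6 := hasSum_pointFunctional_crossF_hrZ (w 5) z zb hz hzb ((Δφ + Δs) / 2) (-1) hΔ hreg hg
  have h7 := hasSum_pointFunctional_crossF_hrZ (w 6) z zb hz hzb ((Δφ + Δs) / 2) 1 hΔ hreg hg
  have hs := (((h2.add h3).mul_left (a ^ 2)).add (h4.mul_left (b ^ 2))).add
    ((h6.add h7).mul_left (a * b))
  have hL : (ofPoints z zb w).singletForm Δφ Δs g a b =
      a ^ 2 * (pointFunctional (w 1) z zb (crossF Δφ (-1) g) + pointFunctional (w 2) z zb (crossF Δφ 1 g)) +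
        b ^ 2 * pointFunctional (w 3) z zb (crossF Δs (-1) g) +
        a * b * (pointFunctional (w 5) z zb (crossF ((Δφ + Δs) / 2) (-1) g) +
          pointFunctional (w 6) z zb (crossF ((Δφ + Δs) / 2) 1 g)) := rfl
  rw [hL]
  exact hs.congr_fun fun q => by simp only [singletTermForm]; ring

/-- **Singlet-row positivity from termwise PSD (finite head + PSD tail terms), regular point.** If the
head form `Σ_{(n,j) ∈ F} (A_{n,j}/λ_ℓ) q_{Δ+n,j}(a,b)` is `≥ 0` for all `(a,b)` and every term form outside
`F` on the descendant range is PSD, then `SingletPositive` at `(Δ, ℓ)`.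
[cite: HogervorstRychkov2013, §3 eq. (3.9)] -/
theorem singletPositive_ofPoints_of_termwise {n : ℕ} (z zb : Fin n → ℝ) (w : Fin 7 → Fin n → ℝ)
    (hz : ∀ k, z k ∈ Ioo (0 : ℝ) 1) (hzb : ∀ k, zb k ∈ Ioo (0 : ℝ) 1) {Δφ Δs Δ : ℝ} {ℓ : ℕ}
    (hΔ : unitarityBound3D ℓ < Δ) (hreg : ¬ accidentalDegeneracy3D Δ ℓ) (F : Finset (ℕ × ℕ))
    (hhead : ∀ a b : ℝ, 0 ≤ ∑ q ∈ F, hrCoeff Δ ℓ q.1 q.2 / legendreLam ℓ *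
      singletTermForm z zb w Δφ Δs (Δ + (q.1 : ℝ)) q.2 a b)
    (htail : ∀ q : ℕ × ℕ, q ∉ F → InDescendantRange ℓ q.1 q.2 →
      ∀ a b : ℝ, 0 ≤ singletTermForm z zb w Δφ Δs (Δ + (q.1 : ℝ)) q.2 a b) :
    (ofPoints z zb w).SingletPositive Δφ Δs Δ ℓ := by
  intro g hg a b
  have hS := hasSum_singletForm_ofPoints z zb w hz hzb hΔ hreg hg Δφ Δs a b
  refine (hhead a b).trans (sum_le_hasSum F (fun q hq => ?_) hS)
  by_cases hr : InDescendantRange ℓ q.1 q.2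
  · exact mul_nonneg (div_nonneg (hrCoeff_nonneg hΔ _ _) (legendreLam_pos ℓ).le) (htail q hq hr a b)
  · rw [hrCoeff_eq_zero_of_not_inDescendantRange Δ hr, zero_div, zero_mul]

/-- **Fully termwise form** (`F = ∅`). [cite: HogervorstRychkov2013, §3 eq. (3.9)] -/
theorem singletPositive_ofPoints_of_forall {n : ℕ} (z zb : Fin n → ℝ) (w : Fin 7 → Fin n → ℝ)
    (hz : ∀ k, z k ∈ Ioo (0 : ℝ) 1) (hzb : ∀ k, zb k ∈ Ioo (0 : ℝ) 1) {Δφ Δs Δ : ℝ} {ℓ : ℕ}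
    (hΔ : unitarityBound3D ℓ < Δ) (hreg : ¬ accidentalDegeneracy3D Δ ℓ)
    (hterm : ∀ q : ℕ × ℕ, InDescendantRange ℓ q.1 q.2 →
      ∀ a b : ℝ, 0 ≤ singletTermForm z zb w Δφ Δs (Δ + (q.1 : ℝ)) q.2 a b) :
    (ofPoints z zb w).SingletPositive Δφ Δs Δ ℓ :=
  singletPositive_ofPoints_of_termwise z zb w hz hzb hΔ hreg ∅ (by simp) (fun q _ hr => hterm q hr)

/-! ### §3 The external obligation from the separate ones -/

/-- **Without gaps excluding `s`, `φ` the external obligation is implied**: if the singlet form is PSD at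
`(Δ_s, 0)` over all genuine blocks and the `V` row is `≥ 0` at `(Δ_φ, 0)`, then `ExtPositive` (the
source's remark "If we did not impose a gap … the last two constraints would imply the first").
[cite: KosPolandSimmonsDuffinVichi2015, §2.2 (OPE-coefficient symmetry)] -/
theorem extPositive_of_separate (α : ArchipelagoFunctional) {Δφ Δs : ℝ}
    (hS : α.SingletPositive Δφ Δs Δs 0) (hV : α.VectorPositive Δφ Δs Δφ 0) : α.ExtPositive Δφ Δs :=
  fun gs gφm gφp hgs hgφm hgφp a b =>
    α.extForm_nonneg_of_separate Δφ Δs gs gφm gφp (hS gs hgs) (hV gφm gφp hgφm hgφp) a b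

/-! ### §4 Non-regular points by right limits -/

/-- The `T` row of a point 7-vector is continuous along the limit clause: if `G Δ' → g` pointwise on the
square then `tensorForm(G Δ') → tensorForm(g)`. Elementary. [cite: KosPolandSimmonsduffin2014, §4 eqs. (4.2)–(4.3)] -/
theorem tendsto_tensorForm_ofPoints {n : ℕ} (z zb : Fin n → ℝ) (w : Fin 7 → Fin n → ℝ)
    (hz : ∀ k, z k ∈ Ioo (0 : ℝ) 1) (hzb : ∀ k, zb k ∈ Ioo (0 : ℝ) 1) (N : ℕ) (Δφ : ℝ)
    (G : ℝ → ℝ → ℝ → ℝ) (g : ℝ → ℝ → ℝ) (l : Filter ℝ)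
    (hG : ∀ x y : ℝ, x ∈ Ioo (0 : ℝ) 1 → y ∈ Ioo (0 : ℝ) 1 →
      Tendsto (fun Δ' => G Δ' x y) l (𝓝 (g x y))) :
    Tendsto (fun Δ' => (ofPoints z zb w).tensorForm N Δφ (G Δ')) l
      (𝓝 ((ofPoints z zb w).tensorForm N Δφ g)) := by
  simp only [tensorForm, ofPoints]
  refine Tendsto.sub (Tendsto.add ?_ ?_) ?_
  · exact tendsto_pointFunctional_crossF (w 0) z zb hz hzb Δφ (-1) G g l hG
  · exact Tendsto.const_mul _ (tendsto_pointFunctional_crossF (w 1) z zb hz hzb Δφ (-1) G g l hG)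
  · exact Tendsto.const_mul _ (tendsto_pointFunctional_crossF (w 2) z zb hz hzb Δφ 1 G g l hG)

/-- The `A` row of a point 7-vector is continuous along the limit clause. Elementary.
[cite: KosPolandSimmonsduffin2014, §4 eqs. (4.2)–(4.3)] -/
theorem tendsto_antiForm_ofPoints {n : ℕ} (z zb : Fin n → ℝ) (w : Fin 7 → Fin n → ℝ)
    (hz : ∀ k, z k ∈ Ioo (0 : ℝ) 1) (hzb : ∀ k, zb k ∈ Ioo (0 : ℝ) 1) (Δφ : ℝ)
    (G : ℝ → ℝ → ℝ → ℝ) (g : ℝ → ℝ → ℝ) (l : Filter ℝ)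
    (hG : ∀ x y : ℝ, x ∈ Ioo (0 : ℝ) 1 → y ∈ Ioo (0 : ℝ) 1 →
      Tendsto (fun Δ' => G Δ' x y) l (𝓝 (g x y))) :
    Tendsto (fun Δ' => (ofPoints z zb w).antiForm Δφ (G Δ')) l (𝓝 ((ofPoints z zb w).antiForm Δφ g)) := by
  simp only [antiForm, ofPoints]
  refine Tendsto.sub (Tendsto.add ?_ ?_) ?_
  · exact (tendsto_pointFunctional_crossF (w 0) z zb hz hzb Δφ (-1) G g l hG).neg
  · exact tendsto_pointFunctional_crossF (w 1) z zb hz hzb Δφ (-1) G g l hG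
  · exact tendsto_pointFunctional_crossF (w 2) z zb hz hzb Δφ 1 G g l hG

/-- The singlet form of a point 7-vector is continuous along the limit clause. Elementary.
[cite: KosPolandSimmonsduffin2014, §4 eqs. (4.2)–(4.3)] -/
theorem tendsto_singletForm_ofPoints {n : ℕ} (z zb : Fin n → ℝ) (w : Fin 7 → Fin n → ℝ)
    (hz : ∀ k, z k ∈ Ioo (0 : ℝ) 1) (hzb : ∀ k, zb k ∈ Ioo (0 : ℝ) 1) (Δφ Δs a b : ℝ)
    (G : ℝ → ℝ → ℝ → ℝ) (g : ℝ → ℝ → ℝ) (l : Filter ℝ)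
    (hG : ∀ x y : ℝ, x ∈ Ioo (0 : ℝ) 1 → y ∈ Ioo (0 : ℝ) 1 →
      Tendsto (fun Δ' => G Δ' x y) l (𝓝 (g x y))) :
    Tendsto (fun Δ' => (ofPoints z zb w).singletForm Δφ Δs (G Δ') a b) l
      (𝓝 ((ofPoints z zb w).singletForm Δφ Δs g a b)) := by
  simp only [singletForm, ofPoints]
  refine Tendsto.add (Tendsto.add ?_ ?_) ?_
  · exact Tendsto.const_mul _ (Tendsto.add
      (tendsto_pointFunctional_crossF (w 1) z zb hz hzb Δφ (-1) G g l hG)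
      (tendsto_pointFunctional_crossF (w 2) z zb hz hzb Δφ 1 G g l hG))
  · exact Tendsto.const_mul _ (tendsto_pointFunctional_crossF (w 3) z zb hz hzb Δs (-1) G g l hG)
  · exact Tendsto.const_mul _ (Tendsto.add
      (tendsto_pointFunctional_crossF (w 5) z zb hz hzb _ (-1) G g l hG)
      (tendsto_pointFunctional_crossF (w 6) z zb hz hzb _ 1 G g l hG))

/-- **`T`-row positivity at a non-regular point from the right**: if `(Δ, ℓ)` is not regular and
`TensorPositive` holds at the regular points of a right neighbourhood, it holds at `(Δ, ℓ)` (limit clause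
of `IsConformalBlock3D`, `ge_of_tendsto`). [cite: KosPolandSimmonsduffin2014, §4 eqs. (4.2)–(4.3)] -/
theorem tensorPositive_ofPoints_of_eventually_right {n : ℕ} (z zb : Fin n → ℝ) (w : Fin 7 → Fin n → ℝ)
    (hz : ∀ k, z k ∈ Ioo (0 : ℝ) 1) (hzb : ∀ k, zb k ∈ Ioo (0 : ℝ) 1) (N : ℕ) (Δφ Δ : ℝ) (ℓ : ℕ)
    (hΔ : ¬ IsRegularPoint3D Δ ℓ)
    (h : ∀ᶠ Δ' in 𝓝[>] Δ, IsRegularPoint3D Δ' ℓ ∧ (ofPoints z zb w).TensorPositive N Δφ Δ' ℓ) :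
    (ofPoints z zb w).TensorPositive N Δφ Δ ℓ := by
  intro g hg
  rcases hg with ⟨hreg, _⟩ | ⟨_, G, hGabove, hGlim⟩
  · exact absurd hreg hΔ
  have hlim := tendsto_tensorForm_ofPoints z zb w hz hzb N Δφ G g (𝓝[>] Δ) hGlim
  refine ge_of_tendsto hlim ?_
  have hIoo : Ioo Δ (Δ + 1) ∈ 𝓝[>] Δ := Ioo_mem_nhdsGT (by linarith)
  filter_upwards [h, hIoo] with Δ' hΔ' hmem
  exact hΔ'.2 (G Δ') (Or.inl ⟨hΔ'.1, hGabove Δ' hmem⟩)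

/-- **`A`-row positivity at a non-regular point from the right.** [cite: KosPolandSimmonsduffin2014, §4 eqs. (4.2)–(4.3)] -/
theorem antiPositive_ofPoints_of_eventually_right {n : ℕ} (z zb : Fin n → ℝ) (w : Fin 7 → Fin n → ℝ)
    (hz : ∀ k, z k ∈ Ioo (0 : ℝ) 1) (hzb : ∀ k, zb k ∈ Ioo (0 : ℝ) 1) (Δφ Δ : ℝ) (ℓ : ℕ)
    (hΔ : ¬ IsRegularPoint3D Δ ℓ)
    (h : ∀ᶠ Δ' in 𝓝[>] Δ, IsRegularPoint3D Δ' ℓ ∧ (ofPoints z zb w).AntiPositive Δφ Δ' ℓ) :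
    (ofPoints z zb w).AntiPositive Δφ Δ ℓ := by
  intro g hg
  rcases hg with ⟨hreg, _⟩ | ⟨_, G, hGabove, hGlim⟩
  · exact absurd hreg hΔ
  have hlim := tendsto_antiForm_ofPoints z zb w hz hzb Δφ G g (𝓝[>] Δ) hGlim
  refine ge_of_tendsto hlim ?_
  have hIoo : Ioo Δ (Δ + 1) ∈ 𝓝[>] Δ := Ioo_mem_nhdsGT (by linarith)
  filter_upwards [h, hIoo] with Δ' hΔ' hmem
  exact hΔ'.2 (G Δ') (Or.inl ⟨hΔ'.1, hGabove Δ' hmem⟩)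

/-- **Singlet-row positivity at a non-regular point from the right.** [cite: KosPolandSimmonsduffin2014, §4 eqs. (4.2)–(4.3)] -/
theorem singletPositive_ofPoints_of_eventually_right {n : ℕ} (z zb : Fin n → ℝ)
    (w : Fin 7 → Fin n → ℝ) (hz : ∀ k, z k ∈ Ioo (0 : ℝ) 1) (hzb : ∀ k, zb k ∈ Ioo (0 : ℝ) 1)
    (Δφ Δs Δ : ℝ) (ℓ : ℕ) (hΔ : ¬ IsRegularPoint3D Δ ℓ)
    (h : ∀ᶠ Δ' in 𝓝[>] Δ, IsRegularPoint3D Δ' ℓ ∧ (ofPoints z zb w).SingletPositive Δφ Δs Δ' ℓ) :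
    (ofPoints z zb w).SingletPositive Δφ Δs Δ ℓ := by
  intro g hg a b
  rcases hg with ⟨hreg, _⟩ | ⟨_, G, hGabove, hGlim⟩
  · exact absurd hreg hΔ
  have hlim := tendsto_singletForm_ofPoints z zb w hz hzb Δφ Δs a b G g (𝓝[>] Δ) hGlim
  refine ge_of_tendsto hlim ?_
  have hIoo : Ioo Δ (Δ + 1) ∈ 𝓝[>] Δ := Ioo_mem_nhdsGT (by linarith)
  filter_upwards [h, hIoo] with Δ' hΔ' hmem
  exact hΔ'.2 (G Δ') (Or.inl ⟨hΔ'.1, hGabove Δ' hmem⟩) a b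

/-- **`V`-row positivity at a non-regular point from the right** — through the bridge, from
`oddPositive_ofPoints_of_eventually_right` of the `σ–ε` chain. [cite: KosPolandSimmonsduffin2014, §4 eqs. (4.2)–(4.3)] -/
theorem vectorPositive_ofPoints_of_eventually_right {n : ℕ} (z zb : Fin n → ℝ)
    (w : Fin 7 → Fin n → ℝ) (hz : ∀ k, z k ∈ Ioo (0 : ℝ) 1) (hzb : ∀ k, zb k ∈ Ioo (0 : ℝ) 1)
    (Δφ Δs Δ : ℝ) (ℓ : ℕ) (hΔ : ¬ IsRegularPoint3D Δ ℓ)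
    (h : ∀ᶠ Δ' in 𝓝[>] Δ, IsRegularPoint3D Δ' ℓ ∧ (ofPoints z zb w).VectorPositive Δφ Δs Δ' ℓ) :
    (ofPoints z zb w).VectorPositive Δφ Δs Δ ℓ := by
  rw [vectorPositive_ofPoints_iff]
  refine oddPositive_ofPoints_of_eventually_right z zb (oddWeights w) hz hzb Δφ Δs Δ ℓ hΔ ?_
  filter_upwards [h] with Δ' hΔ'
  exact ⟨hΔ'.1, (vectorPositive_ofPoints_iff z zb w Δφ Δs Δ' ℓ).mp hΔ'.2⟩

end ArchipelagoFunctional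

end Literature.MathematicalPhysics.QuantumFieldTheory.ONArchipelagoSystem
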